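import Mathlib.GroupTheory.Perm.Cycle.Type
import Mathlib.GroupTheory.Perm.Fin
import Mathlib.Data.Fintype.Sum
import Literature.Computability.AlgebraicComplexity.StandardFamilies
import Literature.Computability.AlgebraicComplexity.HamiltonianCycleSumLemmas
import HarnessLib

/-!
# Hamiltonian cycle sums with coupled edges, and the removal of couples

Infrastructure for the `VNP`-hardness of the Hamiltonian cycle family `HC` over every field
(Valiant 1979; von zur Gathen 1987, Thm. 5.6, whose proof simulates Boolean sums by *coupled*
Hamiltonian cycles and then removes the couples one at a time inside "special graphs"). This file
provides the second half of that scheme in a self-contained form: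

* `IsHam π` (`π.cycleType = {#V}`, the summation range of `Matrix.hamiltonianCycleSum`) and its
  unfolding `isHam_iff` (no fixed point, one orbit), `IsHam.pow_apply_ne` (no short cycles),
  invariance under `Equiv.permCongr`;
* the coupled Hamiltonian cycle sum `hcC M P` of a weight matrix `M : Matrix V V R`
  (`M j i` = weight of the edge `i → j`) under a list `P` of couples `{(u,v),(u',v')}`
  (von zur Gathen's `hc(G; P)`: sum over the Hamiltonian permutations `σ` with
  `σ u = v ↔ σ u' = v'` for every couple), `hcC_nil : hcC M [] = HC(M)`, reindexing
  (`hcC_submatrix`), restriction to permutations of full support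
  (`hcC_eq_sum_supp`);
* **the couple-removal gadget** `CoupleData.gadget` and the theorem `CoupleData.hcC_gadget`:
  if `M` is *special* at `(u₀, s₀)` (the only edge out of `u₀` and the only edge into `s₀` is
  `u₀ → s₀`, of weight `1`) then deleting `u → v`, `u' → v'`, `u₀ → s₀` and adding five vertices
  `g₀,…,g₄` with the weight-`1` edges `u₀ → g₀ → g₁ → g₂ → g₃ → g₄ → s₀`, `g₀ → s₀`, `g₁ → v`,
  `g₄ → g₃ → g₂ → v'` and the edges `u → g₁`, `u' → g₄` carrying the weights of `u → v`, `u' → v'`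
  gives a graph, special at `(u₀, g₀)`, whose coupled Hamiltonian cycle sum under `P` equals that
  of `M` under `P ∪ {{(u,v),(u',v')}}`;
* its iteration `exists_hamiltonianCycleSum_eq_hcC`: for a well-formed list of `p` couples
  (`GoodCouples`) there is a matrix of size `#V + 5p` with entries among those of `M` and `0, 1`
  whose ordinary Hamiltonian cycle sum is `hc(M; P)`.

## The gadget and its proof

von zur Gathen's construction `C = γ(H, {e, e'})` ((11.1)–(11.3), six new vertices
`a₁, a₂, a₃, b, c₁, c₂`, Figures 19–21 of the paper) is replaced by a five-vertex gadget found and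
checked by exhaustive search; the proof is the one indicated in print ("one checks that any
`σ ∈ S₁` has the form in Fig. 20 and any `σ ∈ S₂` has the form in Fig. 21", followed by the
bijections `α₁`, `α₂`), organised as follows. A Hamiltonian permutation of the new graph using
only edges of nonzero weight (`Supp`) satisfies the local constraints `supp_*` (successors and
predecessors of the gadget vertices); exhausting them (`local_cases`) leaves exactly two patterns,
*neither* (`u₀ → g₀ → ⋯ → g₄ → s₀`, the coupled edges replaced by nothing) and *both*
(`u₀ → g₀ → s₀`, `u → g₁ → v`, `u' → g₄ → g₃ → g₂ → v'`) — the spurious local configurations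
contain one of the `2`-cycles `(g₃ g₄)`, `(g₂ g₃)` or leave `s₀` without predecessor. Conversely a permutation `τ`
of `V` is *glued* into the new graph by composing its lift with a fixed insertion permutation
(`pN`, `pB`, `glue`); gluing preserves and reflects Hamiltonicity (`isHam_glue`,
`isHam_of_isHam_glue`, via orbits and the `anchor` map), preserves weights (`prod_gadget_glue`)
and the other couples (`sat_glue_iff`), and every admissible Hamiltonian permutation of the new
graph is glued (`exists_glue_eq`, using `Equiv.Perm.mem_sumCongrHom_range_of_perm_mapsTo_inl`).
The theorem is then a bijection of summation ranges (`Finset.sum_nbij`).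

Reused from `HamiltonianCycleSumLemmas.lean`: `Equiv.Perm.cycleType_permCongr`
(`isHam_permCongr`), `Equiv.Perm.pow_apply_ne_self_of_cycleType` (`IsHam.pow_apply_ne`),
`Matrix.hamiltonianCycleSum_term_eq_zero` (`prod_eq_zero_of_not_supp`) and
`Matrix.hamiltonianCycleSum_submatrix_equiv` (reindexing to `Fin N` in
`exists_hamiltonianCycleSum_eq_hcC`); the `IsHam` phrasings are kept as one-line wrappers.

## References

* L. G. Valiant, *Completeness classes in algebra*, Proc. 11th STOC (1979), 249–261.
* J. von zur Gathen, *Feasible arithmetic computations: Valiant's hypothesis*, J. Symbolic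
  Comput. 4 (1987), 137–172, §5: coupled permanents and Hamiltonians, Thm. 5.6 and its proof,
  (11.1)–(11.3), (12.1)–(12.3).
* P. Bürgisser, *Completeness and Reduction in Algebraic Complexity Theory*, Springer 2000,
  (2.3) (`HC_n`), Thm. 2.10.
-/

noncomputable section

open Equiv Finset

namespace Literature.Computability.AlgebraicComplexity

universe u v

/-! ### Hamiltonian permutations -/

section Ham

variable {V : Type u} [Fintype V] [DecidableEq V]

/-- A permutation of the vertex set is *Hamiltonian* if it is a single cycle through all
vertices, i.e. its cycle type is `{#V}` (the summation range of `Matrix.hamiltonianCycleSum`;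
Bürgisser 2000, (2.3)). [cite: Burgisser2000, (2.3)] -/
def IsHam (π : Perm V) : Prop :=
  π.cycleType = {Fintype.card V}

/-- Hamiltonicity is decidable (equality of cycle types). [folklore] -/
instance IsHam.decidable (π : Perm V) : Decidable (IsHam π) := by
  unfold IsHam; infer_instance

omit [DecidableEq V] in
/-- A Hamiltonian permutation, unfolded: no fixed point and a single orbit (for `#V ≥ 2`). [folklore] -/
theorem isHam_iff [DecidableEq V] (h2 : 2 ≤ Fintype.card V) (π : Perm V) :
    IsHam π ↔ (∀ x, π x ≠ x) ∧ ∀ x y, π.SameCycle x y := by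
  constructor
  · intro h
    have hc : π.IsCycle := by
      rw [← Perm.card_cycleType_eq_one]
      rw [IsHam] at h
      rw [h]
      rfl
    have hsupp : π.support = univ := by
      apply Finset.eq_univ_of_card
      have hs := Perm.sum_cycleType π
      rw [IsHam] at h
      rw [h, Multiset.sum_singleton] at hs
      exact hs.symm
    have hne : ∀ x, π x ≠ x := fun x => by
      rw [← Perm.mem_support, hsupp]; exact mem_univ x
    exact ⟨hne, fun x y => hc.sameCycle (hne x) (hne y)⟩
  · rintro ⟨hne, hsc⟩
    have hpos : 0 < Fintype.card V := by omega
    obtain ⟨x₀⟩ := Fintype.card_pos_iff.1 hpos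
    have hc : π.IsCycle := ⟨x₀, hne x₀, fun y _ => hsc x₀ y⟩
    have hsupp : π.support = univ := by
      ext x; simp [Perm.mem_support, hne x]
    rw [IsHam, hc.cycleType, hsupp, card_univ]

omit [DecidableEq V] in
/-- A Hamiltonian permutation has no cycle shorter than `#V`: `π^j x ≠ x` for `0 < j < #V`
(`Equiv.Perm.pow_apply_ne_self_of_cycleType` of `HamiltonianCycleSumLemmas.lean`, in `IsHam`
phrasing). [folklore] -/
theorem IsHam.pow_apply_ne [DecidableEq V] {π : Perm V} (h : IsHam π) {j : ℕ} (hj0 : 0 < j)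
    (hj : j < Fintype.card V) (x : V) : (π ^ j) x ≠ x :=
  Equiv.Perm.pow_apply_ne_self_of_cycleType h hj0 hj x

omit [DecidableEq V] in
/-- A Hamiltonian permutation of at least two vertices has no fixed point. [folklore] -/
theorem IsHam.apply_ne [DecidableEq V] {π : Perm V} (h : IsHam π) (h2 : 2 ≤ Fintype.card V)
    (x : V) : π x ≠ x := by
  simpa using h.pow_apply_ne Nat.one_pos h2 x

omit [DecidableEq V] in
/-- A Hamiltonian permutation of at least three vertices has no `2`-cycle. [folklore] -/
theorem IsHam.apply_apply_ne [DecidableEq V] {π : Perm V} (h : IsHam π) (h3 : 3 ≤ Fintype.card V)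
    (x : V) : π (π x) ≠ x := by
  simpa [pow_two] using h.pow_apply_ne (j := 2) (by norm_num) h3 x

omit [DecidableEq V] in
/-- Hamiltonicity is invariant under conjugation by an equivalence of vertex types
(`Equiv.Perm.cycleType_permCongr` of `HamiltonianCycleSumLemmas.lean`). [folklore] -/
theorem isHam_permCongr [DecidableEq V] {W : Type*} [Fintype W] [DecidableEq W] (e : V ≃ W)
    (π : Perm V) : IsHam (e.permCongr π) ↔ IsHam π := by
  simp only [IsHam, Equiv.Perm.cycleType_permCongr, Fintype.card_congr e]

end Ham

/-! ### Hamiltonian cycle sums with coupled edges -/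

section Coupled

variable {V : Type u} [Fintype V] [DecidableEq V] {R : Type v} [CommSemiring R]

/-- A *couple* of edges `{(u, v), (u', v')}` of a digraph on `V` (von zur Gathen 1987, §5: a set of
couples constrains the permutations `σ` by `(u, v) ∈ σ ↔ (u', v') ∈ σ`). [cite: vonzurGathen1987, §5] -/
abbrev Couple (V : Type u) : Type u := (V × V) × (V × V)

/-- `σ` respects the couple `c = {e, e'}`: `e ∈ σ ↔ e' ∈ σ`, where `(u, v) ∈ σ` means `σ u = v`
(von zur Gathen 1987, §5, `Sym(G; P)`). [cite: vonzurGathen1987, §5] -/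
def Couple.Sat (σ : Perm V) (c : Couple V) : Prop :=
  σ c.1.1 = c.1.2 ↔ σ c.2.1 = c.2.2

/-- Respecting a couple is decidable. [folklore] -/
instance Couple.decidableSat (σ : Perm V) (c : Couple V) : Decidable (Couple.Sat σ c) :=
  inferInstanceAs (Decidable (_ ↔ _))

/-- Transport of a couple along a map of vertex types. [folklore] -/
def Couple.map {W : Type*} (f : V → W) (c : Couple V) : Couple W :=
  ((f c.1.1, f c.1.2), (f c.2.1, f c.2.2))

/-- The *coupled Hamiltonian cycle sum* `hc(M; P) = ∑_{σ ∈ HC(M; P)} ∏ᵢ M (σ i) i` of a weight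
matrix `M` (`M j i` = weight of the edge `i → j`, the convention of `Matrix.hamiltonianCycleSum`)
over the Hamiltonian permutations respecting every couple of the list `P`
(von zur Gathen 1987, §5, `hc(G; P)`). [cite: vonzurGathen1987, §5] -/
def hcC (M : Matrix V V R) (P : List (Couple V)) : R :=
  ∑ σ ∈ univ.filter (fun σ : Perm V => IsHam σ ∧ ∀ c ∈ P, Couple.Sat σ c), ∏ i, M (σ i) i

/-- `σ` has *full support* in `M`: every edge `i → σ i` it uses has a nonzero weight (the other
permutations contribute `0` to every cycle sum). [folklore] -/
def Supp (M : Matrix V V R) (σ : Perm V) : Prop :=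
  ∀ i, M (σ i) i ≠ 0

omit [DecidableEq V] in
/-- A permutation without full support contributes `0` (`Matrix.hamiltonianCycleSum_term_eq_zero`). [folklore] -/
theorem prod_eq_zero_of_not_supp {M : Matrix V V R} {σ : Perm V} (h : ¬ Supp M σ) :
    ∏ i, M (σ i) i = 0 := by
  simp only [Supp, not_forall, not_not] at h
  obtain ⟨i, hi⟩ := h
  exact Matrix.hamiltonianCycleSum_term_eq_zero hi

open scoped Classical in
/-- The coupled Hamiltonian cycle sum is a sum over permutations of full support. [folklore] -/
theorem hcC_eq_sum_supp (M : Matrix V V R) (P : List (Couple V)) :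
    hcC M P = ∑ σ ∈ univ.filter (fun σ : Perm V =>
      (IsHam σ ∧ ∀ c ∈ P, Couple.Sat σ c) ∧ Supp M σ), ∏ i, M (σ i) i := by
  classical
  rw [hcC]
  symm
  rw [show univ.filter (fun σ : Perm V => (IsHam σ ∧ ∀ c ∈ P, Couple.Sat σ c) ∧ Supp M σ) =
    (univ.filter (fun σ : Perm V => IsHam σ ∧ ∀ c ∈ P, Couple.Sat σ c)).filter (Supp M) by
      ext σ; simp [and_assoc]]
  exact Finset.sum_filter_of_ne fun σ _ h => by
    by_contra h'
    exact h (prod_eq_zero_of_not_supp h')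

/-- Without couples, `hc(M; ∅)` is the Hamiltonian cycle sum `HC(M)`. [cite: vonzurGathen1987, §5] -/
theorem hcC_nil (M : Matrix V V R) : hcC M [] = M.hamiltonianCycleSum := by
  unfold hcC Matrix.hamiltonianCycleSum
  refine Finset.sum_congr ?_ fun _ _ => rfl
  ext σ
  simp [IsHam]

/-- Reindexing the vertices along an equivalence does not change the coupled Hamiltonian cycle
sum. [folklore] -/
theorem hcC_submatrix {W : Type*} [Fintype W] [DecidableEq W] (e : V ≃ W) (M : Matrix W W R)
    (P : List (Couple V)) :
    hcC (M.submatrix e e) P = hcC M (P.map (Couple.map e)) := by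
  unfold hcC
  -- reindex the summation along `σ ↦ e.permCongr σ`
  refine Finset.sum_bij' (fun σ _ => e.permCongr σ) (fun ρ _ => e.symm.permCongr ρ) ?_ ?_ ?_ ?_ ?_
  · intro σ hσ
    simp only [mem_filter, mem_univ, true_and] at hσ ⊢
    refine ⟨(isHam_permCongr e σ).2 hσ.1, fun c hc => ?_⟩
    obtain ⟨c₀, hc₀, rfl⟩ := List.mem_map.1 hc
    have := hσ.2 c₀ hc₀
    simp only [Couple.Sat, Couple.map, Equiv.permCongr_apply, Equiv.symm_apply_apply,
      EmbeddingLike.apply_eq_iff_eq] at this ⊢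
    exact this
  · intro ρ hρ
    simp only [mem_filter, mem_univ, true_and] at hρ ⊢
    refine ⟨?_, fun c hc => ?_⟩
    · have := (isHam_permCongr e (e.symm.permCongr ρ)).1
      refine (isHam_permCongr e.symm ρ).2 hρ.1 |> fun h => ?_
      exact h
    · have := hρ.2 (Couple.map e c) (List.mem_map.2 ⟨c, hc, rfl⟩)
      simp only [Couple.Sat, Couple.map, Equiv.permCongr_apply, Equiv.symm_symm] at this ⊢
      constructor
      · intro h1
        rw [Equiv.symm_apply_eq] at h1
        have := this.1 h1
        rw [Equiv.symm_apply_eq]; exact this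
      · intro h1
        rw [Equiv.symm_apply_eq] at h1
        have := this.2 h1
        rw [Equiv.symm_apply_eq]; exact this
  · intro σ _; ext x; simp
  · intro ρ _; ext x; simp
  · intro σ _
    simp only [Matrix.submatrix_apply]
    exact Fintype.prod_equiv e _ _ fun x => by simp

end Coupled

/-! ### The couple-removal gadget -/

section Gadget

variable {V : Type u} [DecidableEq V] {R : Type v} [CommSemiring R]

/-- The data of one couple removal: the special edge `u₀ → s₀` of the graph and the couple
`{(u, v), (u', v')}` to be removed (von zur Gathen 1987, proof of Thm. 5.6, (11.1)–(11.3):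
special graphs and the couple `{e, e'}`). [cite: vonzurGathen1987, Thm. 5.6] -/
structure CoupleData (V : Type u) where
  /-- tail of the special edge -/
  u₀ : V
  /-- head of the special edge -/
  s₀ : V
  /-- tail of the first coupled edge -/
  u : V
  /-- head of the first coupled edge -/
  v : V
  /-- tail of the second coupled edge -/
  u' : V
  /-- head of the second coupled edge -/
  v' : V

namespace CoupleData

variable (d : CoupleData V)

/-- Distinctness of the six vertices as needed by the gadget: the three tails are distinct, the
three heads are distinct, and none of the three edges is a loop. [folklore] -/
structure Distinct : Prop where
  u₀_u : d.u₀ ≠ d.u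
  u₀_u' : d.u₀ ≠ d.u'
  u_u' : d.u ≠ d.u'
  s₀_v : d.s₀ ≠ d.v
  s₀_v' : d.s₀ ≠ d.v'
  v_v' : d.v ≠ d.v'
  u₀_s₀ : d.u₀ ≠ d.s₀
  u_v : d.u ≠ d.v
  u'_v' : d.u' ≠ d.v'

/-- The couple `{(u, v), (u', v')}`. [cite: vonzurGathen1987, Thm. 5.6] -/
def couple : Couple V := ((d.u, d.v), (d.u', d.v'))

/-- The weight matrix `M` (`M y x` = weight of `x → y`) is *special* at `(u₀, s₀)`: the only edge
leaving `u₀` and the only edge entering `s₀` is `u₀ → s₀`, of weight `1` (von zur Gathen 1987,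
proof of Thm. 5.6: "special graphs"). [cite: vonzurGathen1987, Thm. 5.6] -/
structure Special (M : Matrix V V R) : Prop where
  out : ∀ y, y ≠ d.s₀ → M y d.u₀ = 0
  inn : ∀ x, x ≠ d.u₀ → M d.s₀ x = 0
  one : M d.s₀ d.u₀ = 1

/-- An edge `(x, y)` *avoids* the gadget if it is none of `(u, v)`, `(u', v')`, `(u₀, s₀)`. [folklore] -/
def Avoids (e : V × V) : Prop :=
  e ≠ (d.u, d.v) ∧ e ≠ (d.u', d.v') ∧ e ≠ (d.u₀, d.s₀)

/-- **The couple-removal gadget** (a five-vertex variant of von zur Gathen's six-vertex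
construction `C = γ(H, {e, e'})`, (11.1)–(11.3)): the edges `u → v`, `u' → v'` and the special
edge `u₀ → s₀` are deleted; new vertices `g₀, …, g₄` and weight-`1` edges
`u₀ → g₀ → g₁ → g₂ → g₃ → g₄ → s₀`, `g₀ → s₀`, `g₁ → v`, `g₄ → g₃ → g₂ → v'` are added, together
with `u → g₁` of weight `M v u` and `u' → g₄` of weight `M v' u'`. Entry `gadget M d y x` is the
weight of the edge `x → y`. [cite: vonzurGathen1987, Thm. 5.6] -/
def gadget (M : Matrix V V R) : Matrix (V ⊕ Fin 5) (V ⊕ Fin 5) R := fun y x =>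
  match x, y with
  | Sum.inl x, Sum.inl y =>
      if (x = d.u ∧ y = d.v) ∨ (x = d.u' ∧ y = d.v') ∨ (x = d.u₀ ∧ y = d.s₀) then 0 else M y x
  | Sum.inl x, Sum.inr g =>
      if x = d.u₀ ∧ g = 0 then 1 else if x = d.u ∧ g = 1 then M d.v d.u
      else if x = d.u' ∧ g = 4 then M d.v' d.u' else 0
  | Sum.inr g, Sum.inl y =>
      if (g = 0 ∧ y = d.s₀) ∨ (g = 4 ∧ y = d.s₀) ∨ (g = 1 ∧ y = d.v) ∨ (g = 2 ∧ y = d.v') then 1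
      else 0
  | Sum.inr g, Sum.inr g' =>
      if (g = 0 ∧ g' = 1) ∨ (g = 1 ∧ g' = 2) ∨ (g = 2 ∧ g' = 3) ∨ (g = 3 ∧ g' = 4) ∨
        (g = 4 ∧ g' = 3) ∨ (g = 3 ∧ g' = 2) then 1 else 0

/-- The insertion permutation of the *neither* mode: the cycle
`s₀ ↦ g₀ ↦ g₁ ↦ g₂ ↦ g₃ ↦ g₄ ↦ s₀` (composing a permutation `τ` of `V` with it on the left replaces
the edge `u₀ → s₀` of `τ` by the path `u₀ → g₀ → ⋯ → g₄ → s₀`). [folklore] -/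
def pN : Perm (V ⊕ Fin 5) where
  toFun z := match z with
    | Sum.inl y => if y = d.s₀ then Sum.inr 0 else Sum.inl y
    | Sum.inr g => ![Sum.inr 1, Sum.inr 2, Sum.inr 3, Sum.inr 4, Sum.inl d.s₀] g
  invFun z := match z with
    | Sum.inl y => if y = d.s₀ then Sum.inr 4 else Sum.inl y
    | Sum.inr g => ![Sum.inl d.s₀, Sum.inr 0, Sum.inr 1, Sum.inr 2, Sum.inr 3] g
  left_inv z := by
    rcases z with y | g
    · by_cases hy : y = d.s₀ <;> simp [hy]
    · fin_cases g <;> simp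
  right_inv z := by
    rcases z with y | g
    · by_cases hy : y = d.s₀ <;> simp [hy]
    · fin_cases g <;> simp

/-- The insertion permutation of the *both* mode: `s₀ ↔ g₀`, `v ↔ g₁` and the cycle
`v' ↦ g₄ ↦ g₃ ↦ g₂ ↦ v'` (composing `τ` with it on the left replaces the edges `u₀ → s₀`, `u → v`,
`u' → v'` of `τ` by the paths `u₀ → g₀ → s₀`, `u → g₁ → v`, `u' → g₄ → g₃ → g₂ → v'`). [folklore] -/
def pB (h : d.Distinct) : Perm (V ⊕ Fin 5) where
  toFun z := match z with
    | Sum.inl y => if y = d.s₀ then Sum.inr 0 else if y = d.v then Sum.inr 1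
        else if y = d.v' then Sum.inr 4 else Sum.inl y
    | Sum.inr g => ![Sum.inl d.s₀, Sum.inl d.v, Sum.inl d.v', Sum.inr 2, Sum.inr 3] g
  invFun z := match z with
    | Sum.inl y => if y = d.s₀ then Sum.inr 0 else if y = d.v then Sum.inr 1
        else if y = d.v' then Sum.inr 2 else Sum.inl y
    | Sum.inr g => ![Sum.inl d.s₀, Sum.inl d.v, Sum.inr 3, Sum.inr 4, Sum.inl d.v'] g
  left_inv z := by
    have h1 := h.s₀_v; have h2 := h.s₀_v'; have h3 := h.v_v'
    rcases z with y | g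
    · by_cases hy : y = d.s₀
      · subst hy; simp
      · by_cases hv : y = d.v
        · subst hv; simp [hy]
        · by_cases hv' : y = d.v'
          · subst hv'; simp [hy, hv]
          · simp [hy, hv, hv']
    · fin_cases g <;> simp [h1.symm, h2.symm, h3.symm]
  right_inv z := by
    have h1 := h.s₀_v; have h2 := h.s₀_v'; have h3 := h.v_v'
    rcases z with y | g
    · by_cases hy : y = d.s₀
      · subst hy; simp
      · by_cases hv : y = d.v
        · subst hv; simp [hy]
        · by_cases hv' : y = d.v'
          · subst hv'; simp [hy, hv]
          · simp [hy, hv, hv']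
    · fin_cases g <;> simp [h1.symm, h2.symm, h3.symm]

/-- The lift of a permutation of `V` to `V ⊕ Fin 5` fixing the gadget vertices. [folklore] -/
abbrev lift (_d : CoupleData V) (τ : Perm V) : Perm (V ⊕ Fin 5) := Perm.sumCongr τ 1

/-- **Expansion** of a permutation `τ` of `V` to the gadget graph: in the *both* mode
(`τ u = v`) insert the three paths of `pB`, otherwise the path of `pN`. [folklore] -/
def expand (h : d.Distinct) (τ : Perm V) : Perm (V ⊕ Fin 5) :=
  (if τ d.u = d.v then d.pB h else d.pN) * d.lift τ

section Eval

variable {d}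

/-- Unfolding of `pN` on `V`. [folklore] -/
@[simp] theorem pN_inl (y : V) : d.pN (Sum.inl y) = if y = d.s₀ then Sum.inr 0 else Sum.inl y := rfl
/-- Unfolding: `pN g₀ = g₁`. [folklore] -/
@[simp] theorem pN_inr0 : d.pN (Sum.inr 0) = Sum.inr 1 := rfl
/-- Unfolding: `pN g₁ = g₂`. [folklore] -/
@[simp] theorem pN_inr1 : d.pN (Sum.inr 1) = Sum.inr 2 := rfl
/-- Unfolding: `pN g₂ = g₃`. [folklore] -/
@[simp] theorem pN_inr2 : d.pN (Sum.inr 2) = Sum.inr 3 := rfl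
/-- Unfolding: `pN g₃ = g₄`. [folklore] -/
@[simp] theorem pN_inr3 : d.pN (Sum.inr 3) = Sum.inr 4 := rfl
/-- Unfolding: `pN g₄ = s₀`. [folklore] -/
@[simp] theorem pN_inr4 : d.pN (Sum.inr 4) = Sum.inl d.s₀ := rfl
/-- Unfolding of `pB` on `V`. [folklore] -/
@[simp] theorem pB_inl (h : d.Distinct) (y : V) : d.pB h (Sum.inl y) =
    if y = d.s₀ then Sum.inr 0 else if y = d.v then Sum.inr 1
      else if y = d.v' then Sum.inr 4 else Sum.inl y := rfl
/-- Unfolding: `pB g₀ = s₀`. [folklore] -/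
@[simp] theorem pB_inr0 (h : d.Distinct) : d.pB h (Sum.inr 0) = Sum.inl d.s₀ := rfl
/-- Unfolding: `pB g₁ = v`. [folklore] -/
@[simp] theorem pB_inr1 (h : d.Distinct) : d.pB h (Sum.inr 1) = Sum.inl d.v := rfl
/-- Unfolding: `pB g₂ = v'`. [folklore] -/
@[simp] theorem pB_inr2 (h : d.Distinct) : d.pB h (Sum.inr 2) = Sum.inl d.v' := rfl
/-- Unfolding: `pB g₃ = g₂`. [folklore] -/
@[simp] theorem pB_inr3 (h : d.Distinct) : d.pB h (Sum.inr 3) = Sum.inr 2 := rfl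
/-- Unfolding: `pB g₄ = g₃`. [folklore] -/
@[simp] theorem pB_inr4 (h : d.Distinct) : d.pB h (Sum.inr 4) = Sum.inr 3 := rfl

/-- Unfolding of `pN⁻¹` on `V`. [folklore] -/
@[simp] theorem pN_symm_inl (y : V) :
    d.pN.symm (Sum.inl y) = if y = d.s₀ then Sum.inr 4 else Sum.inl y := rfl
/-- Unfolding: `pN⁻¹ g₀ = s₀`. [folklore] -/
@[simp] theorem pN_symm_inr0 : d.pN.symm (Sum.inr 0) = Sum.inl d.s₀ := rfl
/-- Unfolding: `pN⁻¹ g₁ = g₀`. [folklore] -/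
@[simp] theorem pN_symm_inr1 : d.pN.symm (Sum.inr 1) = Sum.inr 0 := rfl
/-- Unfolding: `pN⁻¹ g₂ = g₁`. [folklore] -/
@[simp] theorem pN_symm_inr2 : d.pN.symm (Sum.inr 2) = Sum.inr 1 := rfl
/-- Unfolding: `pN⁻¹ g₃ = g₂`. [folklore] -/
@[simp] theorem pN_symm_inr3 : d.pN.symm (Sum.inr 3) = Sum.inr 2 := rfl
/-- Unfolding: `pN⁻¹ g₄ = g₃`. [folklore] -/
@[simp] theorem pN_symm_inr4 : d.pN.symm (Sum.inr 4) = Sum.inr 3 := rfl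
/-- Unfolding of `pB⁻¹` on `V`. [folklore] -/
@[simp] theorem pB_symm_inl (h : d.Distinct) (y : V) : (d.pB h).symm (Sum.inl y) =
    if y = d.s₀ then Sum.inr 0 else if y = d.v then Sum.inr 1
      else if y = d.v' then Sum.inr 2 else Sum.inl y := rfl
/-- Unfolding: `pB⁻¹ g₀ = s₀`. [folklore] -/
@[simp] theorem pB_symm_inr0 (h : d.Distinct) : (d.pB h).symm (Sum.inr 0) = Sum.inl d.s₀ := rfl
/-- Unfolding: `pB⁻¹ g₁ = v`. [folklore] -/
@[simp] theorem pB_symm_inr1 (h : d.Distinct) : (d.pB h).symm (Sum.inr 1) = Sum.inl d.v := rfl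
/-- Unfolding: `pB⁻¹ g₂ = g₃`. [folklore] -/
@[simp] theorem pB_symm_inr2 (h : d.Distinct) : (d.pB h).symm (Sum.inr 2) = Sum.inr 3 := rfl
/-- Unfolding: `pB⁻¹ g₃ = g₄`. [folklore] -/
@[simp] theorem pB_symm_inr3 (h : d.Distinct) : (d.pB h).symm (Sum.inr 3) = Sum.inr 4 := rfl
/-- Unfolding: `pB⁻¹ g₄ = v'`. [folklore] -/
@[simp] theorem pB_symm_inr4 (h : d.Distinct) : (d.pB h).symm (Sum.inr 4) = Sum.inl d.v' := rfl

omit [DecidableEq V] in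
/-- The lift acts as `τ` on `V`. [folklore] -/
@[simp] theorem lift_inl (τ : Perm V) (x : V) : d.lift τ (Sum.inl x) = Sum.inl (τ x) := rfl
omit [DecidableEq V] in
/-- The lift fixes the gadget vertices. [folklore] -/
@[simp] theorem lift_inr (τ : Perm V) (g : Fin 5) : d.lift τ (Sum.inr g) = Sum.inr g := rfl

end Eval

/-! #### Local analysis: the edges of full support at the gadget -/

section Local

variable {d} {M : Matrix V V R} (hd : d.Distinct) (hM : d.Special M) {σ : Perm (V ⊕ Fin 5)}
  (hs : Supp (d.gadget M) σ)
include hs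

/-- Full support at `u₀`: the special tail enters the gadget, `σ u₀ = g₀`. [folklore] -/
theorem supp_u₀ (hd : d.Distinct) (hM : d.Special M) : σ (Sum.inl d.u₀) = Sum.inr 0 := by
  have h := hs (Sum.inl d.u₀)
  rcases hσ : σ (Sum.inl d.u₀) with y | g
  · exfalso; apply h; rw [hσ]; simp only [gadget]
    split_ifs with h1
    · rfl
    · have hy : y ≠ d.s₀ := fun e => h1 (by simp [e])
      exact hM.out y hy
  · rw [hσ] at h
    have h1 := hd.u₀_u; have h2 := hd.u₀_u'
    fin_cases g <;> simp [gadget, h1, h2] at h ⊢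

/-- Full support at `g₀`: `σ g₀ ∈ {g₁, s₀}`. [folklore] -/
theorem supp_g0 : σ (Sum.inr 0) = Sum.inr 1 ∨ σ (Sum.inr 0) = Sum.inl d.s₀ := by
  have h := hs (Sum.inr 0)
  rcases hσ : σ (Sum.inr 0) with y | g <;> rw [hσ] at h
  · simp [gadget] at h; simp [h.1]
  · fin_cases g <;> simp [gadget] at h ⊢

/-- Full support at `g₁`: `σ g₁ ∈ {g₂, v}`. [folklore] -/
theorem supp_g1 : σ (Sum.inr 1) = Sum.inr 2 ∨ σ (Sum.inr 1) = Sum.inl d.v := by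
  have h := hs (Sum.inr 1)
  rcases hσ : σ (Sum.inr 1) with y | g <;> rw [hσ] at h
  · simp [gadget] at h; simp [h.1]
  · fin_cases g <;> simp [gadget] at h ⊢

/-- Full support at `g₂`: `σ g₂ ∈ {g₃, v'}`. [folklore] -/
theorem supp_g2 : σ (Sum.inr 2) = Sum.inr 3 ∨ σ (Sum.inr 2) = Sum.inl d.v' := by
  have h := hs (Sum.inr 2)
  rcases hσ : σ (Sum.inr 2) with y | g <;> rw [hσ] at h
  · simp [gadget] at h; simp [h.1]
  · fin_cases g <;> simp [gadget] at h ⊢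

/-- Full support at `g₃`: `σ g₃ ∈ {g₄, g₂}`. [folklore] -/
theorem supp_g3 : σ (Sum.inr 3) = Sum.inr 4 ∨ σ (Sum.inr 3) = Sum.inr 2 := by
  have h := hs (Sum.inr 3)
  rcases hσ : σ (Sum.inr 3) with y | g <;> rw [hσ] at h
  · simp [gadget] at h
  · fin_cases g <;> simp [gadget] at h ⊢

/-- Full support at `g₄`: `σ g₄ ∈ {s₀, g₃}`. [folklore] -/
theorem supp_g4 : σ (Sum.inr 4) = Sum.inl d.s₀ ∨ σ (Sum.inr 4) = Sum.inr 3 := by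
  have h := hs (Sum.inr 4)
  rcases hσ : σ (Sum.inr 4) with y | g <;> rw [hσ] at h
  · simp [gadget] at h; simp [h.1]
  · fin_cases g <;> simp [gadget] at h ⊢

/-- Full support into `g₁`: its predecessor is `g₀` or `u`. [folklore] -/
theorem supp_to_g1 (hd : d.Distinct) {z : V ⊕ Fin 5} (hz : σ z = Sum.inr 1) :
    z = Sum.inr 0 ∨ z = Sum.inl d.u := by
  have h := hs z
  rw [hz] at h
  have h1 := hd.u₀_u
  rcases z with x | g
  · by_cases hx : x = d.u
    · simp [hx]
    · simp [gadget, hx] at h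
  · fin_cases g <;> simp [gadget] at h ⊢

/-- Full support into `g₂`: its predecessor is `g₁` or `g₃`. [folklore] -/
theorem supp_to_g2 {z : V ⊕ Fin 5} (hz : σ z = Sum.inr 2) :
    z = Sum.inr 1 ∨ z = Sum.inr 3 := by
  have h := hs z
  rw [hz] at h
  rcases z with x | g
  · simp [gadget] at h
  · fin_cases g <;> simp [gadget] at h ⊢

/-- Full support into `g₃`: its predecessor is `g₂` or `g₄`. [folklore] -/
theorem supp_to_g3 {z : V ⊕ Fin 5} (hz : σ z = Sum.inr 3) :
    z = Sum.inr 2 ∨ z = Sum.inr 4 := by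
  have h := hs z
  rw [hz] at h
  rcases z with x | g
  · simp [gadget] at h
  · fin_cases g <;> simp [gadget] at h ⊢

/-- Full support into `g₄`: its predecessor is `g₃` or `u'`. [folklore] -/
theorem supp_to_g4 (hd : d.Distinct) {z : V ⊕ Fin 5} (hz : σ z = Sum.inr 4) :
    z = Sum.inr 3 ∨ z = Sum.inl d.u' := by
  have h := hs z
  rw [hz] at h
  have h1 := hd.u₀_u'; have h2 := hd.u_u'
  rcases z with x | g
  · by_cases hx : x = d.u'
    · simp [hx]
    · simp [gadget, hx] at h
  · fin_cases g <;> simp [gadget] at h ⊢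

/-- Full support into `g₀`: its predecessor is `u₀`. [folklore] -/
theorem supp_to_g0 {z : V ⊕ Fin 5} (hz : σ z = Sum.inr 0) : z = Sum.inl d.u₀ := by
  have h := hs z
  rw [hz] at h
  rcases z with x | g
  · by_cases hx : x = d.u₀
    · rw [hx]
    · simp [gadget, hx] at h
  · fin_cases g <;> simp [gadget] at h ⊢

/-- Full support into `s₀`: its predecessor is `g₀` or `g₄` (the special edge is deleted). [folklore] -/
theorem supp_to_s₀ (hd : d.Distinct) (hM : d.Special M) {z : V ⊕ Fin 5}
    (hz : σ z = Sum.inl d.s₀) : z = Sum.inr 0 ∨ z = Sum.inr 4 := by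
  have h := hs z
  rw [hz] at h
  have h1 := hd.s₀_v; have h2 := hd.s₀_v'
  rcases z with x | g
  · exfalso; apply h; simp only [gadget]
    split_ifs with h1
    · rfl
    · have hx : x ≠ d.u₀ := fun e => h1 (by simp [e])
      exact hM.inn x hx
  · fin_cases g <;> simp [gadget, h1, h2] at h ⊢

/-- Full support at `u`: the deleted edge `u → v` is not used. [folklore] -/
theorem supp_u_ne : σ (Sum.inl d.u) ≠ Sum.inl d.v := by
  intro hz
  have h := hs (Sum.inl d.u)
  rw [hz] at h
  simp [gadget] at h

/-- Full support at `u'`: the deleted edge `u' → v'` is not used. [folklore] -/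
theorem supp_u'_ne : σ (Sum.inl d.u') ≠ Sum.inl d.v' := by
  intro hz
  have h := hs (Sum.inl d.u')
  rw [hz] at h
  simp [gadget] at h

/-- The *neither* pattern: the gadget is traversed as `u₀ → g₀ → g₁ → g₂ → g₃ → g₄ → s₀`. [folklore] -/
def Neither (d : CoupleData V) (σ : Perm (V ⊕ Fin 5)) : Prop :=
  σ (Sum.inr 0) = Sum.inr 1 ∧ σ (Sum.inr 1) = Sum.inr 2 ∧ σ (Sum.inr 2) = Sum.inr 3 ∧
    σ (Sum.inr 3) = Sum.inr 4 ∧ σ (Sum.inr 4) = Sum.inl d.s₀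

/-- The *both* pattern: the gadget is traversed as `u₀ → g₀ → s₀`, `u → g₁ → v`,
`u' → g₄ → g₃ → g₂ → v'`. [folklore] -/
def Both (d : CoupleData V) (σ : Perm (V ⊕ Fin 5)) : Prop :=
  σ (Sum.inr 0) = Sum.inl d.s₀ ∧ σ (Sum.inl d.u) = Sum.inr 1 ∧ σ (Sum.inr 1) = Sum.inl d.v ∧
    σ (Sum.inl d.u') = Sum.inr 4 ∧ σ (Sum.inr 4) = Sum.inr 3 ∧ σ (Sum.inr 3) = Sum.inr 2 ∧
    σ (Sum.inr 2) = Sum.inl d.v'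

/-- **The local lemma of the gadget.** A Hamiltonian permutation of full support traverses the
gadget either in the *neither* or in the *both* pattern (exhaustion of the successor choices; the
spurious local configurations contain one of the `2`-cycles `(g₃ g₄)`, `(g₂ g₃)` or leave `s₀`
without a predecessor). [folklore] -/
theorem local_cases [Fintype V] (hd : d.Distinct) (hM : d.Special M) (hham : IsHam σ) :
    d.Neither σ ∨ d.Both σ := by
  have h3 : 3 ≤ Fintype.card (V ⊕ Fin 5) := by simp [Fintype.card_sum]
  have h2cyc := fun x => hham.apply_apply_ne h3 x
  have inj := σ.injective
  rcases supp_g0 hs with h0 | h0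
  · rcases supp_g1 hs with h1 | h1
    · rcases supp_g2 hs with h2 | h2
      · have h3' : σ (Sum.inr 3) = Sum.inr 4 := by
          rcases supp_g3 hs with h | h
          · exact h
          · exact absurd (inj (h.trans h1.symm)) (by simp)
        have h4 : σ (Sum.inr 4) = Sum.inl d.s₀ := by
          rcases supp_g4 hs with h | h
          · exact h
          · exact absurd (inj (h.trans h2.symm)) (by simp)
        exact Or.inl ⟨h0, h1, h2, h3', h4⟩
      · exfalso
        have h4 : σ (Sum.inr 4) = Sum.inr 3 := by
          rcases supp_g4 hs with h | h
          · obtain ⟨z, hz⟩ := σ.surjective (Sum.inr 3)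
            rcases supp_to_g3 hs hz with rfl | rfl
            · rw [h2] at hz; simp at hz
            · rw [h] at hz; simp at hz
          · exact h
        rcases supp_g3 hs with h | h
        · exact h2cyc (Sum.inr 4) (by rw [h4, h])
        · exact absurd (inj (h.trans h1.symm)) (by simp)
    · exfalso
      have h3' : σ (Sum.inr 3) = Sum.inr 2 := by
        obtain ⟨z, hz⟩ := σ.surjective (Sum.inr 2)
        rcases supp_to_g2 hs hz with rfl | rfl
        · rw [h1] at hz; simp at hz
        · exact hz
      have h2 : σ (Sum.inr 2) = Sum.inl d.v' := by
        rcases supp_g2 hs with h | h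
        · exact absurd (show σ (σ (Sum.inr 3)) = Sum.inr 3 by rw [h3', h]) (h2cyc _)
        · exact h
      have h4 : σ (Sum.inr 4) = Sum.inr 3 := by
        obtain ⟨z, hz⟩ := σ.surjective (Sum.inr 3)
        rcases supp_to_g3 hs hz with rfl | rfl
        · rw [h2] at hz; simp at hz
        · exact hz
      obtain ⟨z, hz⟩ := σ.surjective (Sum.inl d.s₀)
      rcases supp_to_s₀ hs hd hM hz with rfl | rfl
      · rw [h0] at hz; simp at hz
      · rw [h4] at hz; simp at hz
  · have h4 : σ (Sum.inr 4) = Sum.inr 3 := by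
      rcases supp_g4 hs with h | h
      · exact absurd (inj (h.trans h0.symm)) (by simp)
      · exact h
    have h3' : σ (Sum.inr 3) = Sum.inr 2 := by
      rcases supp_g3 hs with h | h
      · exact absurd (show σ (σ (Sum.inr 4)) = Sum.inr 4 by rw [h4, h]) (h2cyc _)
      · exact h
    have h2 : σ (Sum.inr 2) = Sum.inl d.v' := by
      rcases supp_g2 hs with h | h
      · exact absurd (show σ (σ (Sum.inr 3)) = Sum.inr 3 by rw [h3', h]) (h2cyc _)
      · exact h
    have h1 : σ (Sum.inr 1) = Sum.inl d.v := by
      rcases supp_g1 hs with h | h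
      · exact absurd (inj (h.trans h3'.symm)) (by simp)
      · exact h
    have hu : σ (Sum.inl d.u) = Sum.inr 1 := by
      obtain ⟨z, hz⟩ := σ.surjective (Sum.inr 1)
      rcases supp_to_g1 hs hd hz with rfl | rfl
      · rw [h0] at hz; simp at hz
      · exact hz
    have hu' : σ (Sum.inl d.u') = Sum.inr 4 := by
      obtain ⟨z, hz⟩ := σ.surjective (Sum.inr 4)
      rcases supp_to_g4 hs hd hz with rfl | rfl
      · rw [h3'] at hz; simp at hz
      · exact hz
    exact Or.inr ⟨h0, hu, h1, hu', h4, h3', h2⟩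

end Local

/-! #### Gluing: inserting the gadget paths into a permutation of `V` -/

section Glue

variable {d}

/-- The insertion permutation of mode `b` (`true` = both, `false` = neither). [folklore] -/
def ins (hd : d.Distinct) (b : Bool) : Perm (V ⊕ Fin 5) := bif b then d.pB hd else d.pN

/-- Gluing the gadget paths of mode `b` into the lift of `τ`. [folklore] -/
def glue (hd : d.Distinct) (b : Bool) (τ : Perm V) : Perm (V ⊕ Fin 5) := ins hd b * d.lift τ

/-- `τ` is consistent with mode `b`: it uses the special edge, and it uses both coupled edges
(`b = true`) or neither (`b = false`). [folklore] -/
def ModeOK (d : CoupleData V) (b : Bool) (τ : Perm V) : Prop :=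
  τ d.u₀ = d.s₀ ∧ (τ d.u = d.v ↔ b = true) ∧ (τ d.u' = d.v' ↔ b = true)

/-- The expansion is the gluing of the mode read off `τ u`. [folklore] -/
theorem expand_eq_glue (hd : d.Distinct) (τ : Perm V) :
    d.expand hd τ = glue hd (decide (τ d.u = d.v)) τ := by
  unfold expand glue ins
  by_cases h : τ d.u = d.v <;> simp [h]

variable (hd : d.Distinct) {b : Bool} {τ : Perm V} {M : Matrix V V R}

/-- A glued permutation acts on the gadget by the insertion permutation. [folklore] -/
@[simp] theorem glue_inr (g : Fin 5) : glue hd b τ (Sum.inr g) = ins hd b (Sum.inr g) := by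
  simp [glue, Perm.mul_apply]

/-- A glued permutation acts on `V` by `τ` followed by the insertion permutation. [folklore] -/
theorem glue_inl (x : V) : glue hd b τ (Sum.inl x) = ins hd b (Sum.inl (τ x)) := by
  simp [glue, Perm.mul_apply]

/-- The insertion permutation of the neither mode is `pN`. [folklore] -/
@[simp] theorem ins_false : ins hd false = d.pN := rfl
/-- The insertion permutation of the both mode is `pB`. [folklore] -/
@[simp] theorem ins_true : ins hd true = d.pB hd := rfl

/-- A glued permutation sends `u₀` to `g₀`. [folklore] -/
theorem glue_u₀ (hτ : d.ModeOK b τ) : glue hd b τ (Sum.inl d.u₀) = Sum.inr 0 := by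
  rw [glue_inl, hτ.1]; cases b <;> simp

/-- In the both mode a glued permutation sends `u` to `g₁`. [folklore] -/
theorem glue_u_true (hτ : d.ModeOK true τ) : glue hd true τ (Sum.inl d.u) = Sum.inr 1 := by
  rw [glue_inl, hτ.2.1.2 rfl]; simp [hd.s₀_v.symm]

/-- In the both mode a glued permutation sends `u'` to `g₄`. [folklore] -/
theorem glue_u'_true (hτ : d.ModeOK true τ) : glue hd true τ (Sum.inl d.u') = Sum.inr 4 := by
  rw [glue_inl, hτ.2.2.2 rfl]; simp [hd.s₀_v'.symm, hd.v_v'.symm]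

/-- The vertices of `V` whose image is not rerouted into the gadget. [folklore] -/
def Plain (d : CoupleData V) (b : Bool) (x : V) : Prop :=
  x ≠ d.u₀ ∧ (b = true → x ≠ d.u ∧ x ≠ d.u')

/-- On plain vertices a glued permutation is (the lift of) `τ`. [folklore] -/
theorem glue_inl_plain (hτ : d.ModeOK b τ) {x : V} (hx : d.Plain b x) :
    glue hd b τ (Sum.inl x) = Sum.inl (τ x) := by
  rw [glue_inl]
  have h0 : τ x ≠ d.s₀ := fun e => hx.1 (τ.injective (e.trans hτ.1.symm))
  cases b
  · simp [h0]
  · obtain ⟨hu, hu'⟩ := hx.2 rfl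
    have h1 : τ x ≠ d.v := fun e => hu (τ.injective (e.trans (hτ.2.1.2 rfl).symm))
    have h2 : τ x ≠ d.v' := fun e => hu' (τ.injective (e.trans (hτ.2.2.2 rfl).symm))
    simp [h0, h1, h2]

/-- Every vertex of `V` is plain or one of the rerouted tails. [folklore] -/
theorem plain_or (b : Bool) (x : V) :
    d.Plain b x ∨ x = d.u₀ ∨ (b = true ∧ (x = d.u ∨ x = d.u')) := by
  unfold Plain
  by_cases h0 : x = d.u₀
  · exact Or.inr (Or.inl h0)
  · cases b
    · exact Or.inl ⟨h0, fun h => Bool.noConfusion h⟩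
    · by_cases hu : x = d.u
      · exact Or.inr (Or.inr ⟨rfl, Or.inl hu⟩)
      · by_cases hu' : x = d.u'
        · exact Or.inr (Or.inr ⟨rfl, Or.inr hu'⟩)
        · exact Or.inl ⟨h0, fun _ => ⟨hu, hu'⟩⟩

/-- **Weights on `V`**: the glued permutation uses, at a vertex `x ∈ V`, an edge of the same
weight as `τ` does. [folklore] -/
theorem gadget_glue_inl (hM : d.Special M) (hτ : d.ModeOK b τ) (x : V) :
    d.gadget M (glue hd b τ (Sum.inl x)) (Sum.inl x) = M (τ x) x := by
  rcases plain_or (d := d) b x with hx | rfl | ⟨rfl, rfl | rfl⟩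
  · rw [glue_inl_plain hd hτ hx]
    simp only [gadget]
    rw [if_neg]
    rintro (⟨rfl, h⟩ | ⟨rfl, h⟩ | ⟨rfl, h⟩)
    · cases b
      · exact (hτ.2.1.not.2 (by simp)) h
      · exact (hx.2 rfl).1 rfl
    · cases b
      · exact (hτ.2.2.not.2 (by simp)) h
      · exact (hx.2 rfl).2 rfl
    · exact hx.1 rfl
  · rw [glue_u₀ hd hτ, hτ.1, hM.one]; simp [gadget]
  · rw [glue_u_true hd hτ, hτ.2.1.2 rfl]
    have := hd.u₀_u
    simp [gadget]
  · rw [glue_u'_true hd hτ, hτ.2.2.2 rfl]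
    simp [gadget]

/-- **Weights on the gadget**: every gadget edge used by a glued permutation has weight `1`. [folklore] -/
theorem gadget_glue_inr (g : Fin 5) : d.gadget M (glue hd b τ (Sum.inr g)) (Sum.inr g) = 1 := by
  rw [glue_inr]
  have h1 := hd.s₀_v; have h2 := hd.s₀_v'; have h3 := hd.v_v'
  cases b <;> fin_cases g <;> simp [gadget, h1, h2, h3, h1.symm, h2.symm, h3.symm]

/-- The weight of a glued permutation is the weight of `τ`. [folklore] -/
theorem prod_gadget_glue [Fintype V] (hM : d.Special M) (hτ : d.ModeOK b τ) :
    ∏ z, d.gadget M (glue hd b τ z) z = ∏ x, M (τ x) x := by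
  rw [Fintype.prod_sum_type]
  simp only [gadget_glue_inl hd hM hτ, gadget_glue_inr hd, Finset.prod_const_one, mul_one]

/-- Full support transfers along gluing (in a nontrivial coefficient ring). [folklore] -/
theorem supp_glue_iff [Nontrivial R] (hM : d.Special M) (hτ : d.ModeOK b τ) :
    Supp (d.gadget M) (glue hd b τ) ↔ Supp M τ := by
  constructor
  · intro h x
    have := h (Sum.inl x)
    rwa [gadget_glue_inl hd hM hτ] at this
  · intro h z
    rcases z with x | g
    · rw [gadget_glue_inl hd hM hτ]; exact h x
    · rw [gadget_glue_inr hd]; exact one_ne_zero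

/-- **Coupled edges transfer along gluing**: an edge avoiding the gadget is used by the glued
permutation iff it is used by `τ`. [folklore] -/
theorem glue_inl_eq_inl_iff (hτ : d.ModeOK b τ) {a w : V} (ha : d.Avoids (a, w)) :
    glue hd b τ (Sum.inl a) = Sum.inl w ↔ τ a = w := by
  constructor
  · intro h
    rw [glue_inl] at h
    cases b
    · simp only [ins_false, pN_inl] at h
      split_ifs at h with h1
      · simpa using h
    · simp only [ins_true, pB_inl] at h
      split_ifs at h with h1 h2 h3
      · simpa using h
  · intro h
    have hx : d.Plain b a := by
      refine ⟨fun e => ?_, fun hb => ⟨fun e => ?_, fun e => ?_⟩⟩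
      · subst e; exact ha.2.2 (by rw [← h, hτ.1])
      · subst e; subst hb; exact ha.1 (by rw [← h, hτ.2.1.2 rfl])
      · subst e; subst hb; exact ha.2.1 (by rw [← h, hτ.2.2.2 rfl])
    rw [glue_inl_plain hd hτ hx, h]

/-- A couple avoiding the gadget is respected by the glued permutation iff `τ` respects it. [folklore] -/
theorem sat_glue_iff (hτ : d.ModeOK b τ) {c : Couple V} (h1 : d.Avoids c.1) (h2 : d.Avoids c.2) :
    Couple.Sat (glue hd b τ) (c.map Sum.inl) ↔ Couple.Sat τ c := by
  unfold Couple.Sat Couple.map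
  dsimp only
  rw [glue_inl_eq_inl_iff hd hτ h1, glue_inl_eq_inl_iff hd hτ h2]

omit [DecidableEq V] in
/-- A permutation consistent with a mode respects the couple `{(u, v), (u', v')}`. [folklore] -/
theorem sat_couple_of_modeOK (hτ : d.ModeOK b τ) : Couple.Sat τ d.couple := by
  unfold Couple.Sat couple
  dsimp only
  rw [hτ.2.1, hτ.2.2]

end Glue

/-! #### Hamiltonicity transfers along gluing -/

section HamTransfer

variable {d} [Fintype V] (hd : d.Distinct) {b : Bool} {τ : Perm V}

omit [DecidableEq V] in
/-- `V` has at least the three vertices `u₀, u, u'`. [folklore] -/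
theorem three_le_card (hd : d.Distinct) : 3 ≤ Fintype.card V := by
  classical
  have h3 : ({d.u₀, d.u, d.u'} : Finset V).card = 3 := by
    rw [Finset.card_insert_of_notMem, Finset.card_insert_of_notMem, Finset.card_singleton]
    · simp [hd.u_u']
    · simp [hd.u₀_u, hd.u₀_u']
  exact h3 ▸ Finset.card_le_univ _

omit [DecidableEq V] in
/-- The gadget graph has at least two vertices. [folklore] -/
theorem two_le_card_sum : 2 ≤ Fintype.card (V ⊕ Fin 5) := by
  simp [Fintype.card_sum]

omit [Fintype V] in
/-- One `τ`-step is simulated by `1`, `2`, `4` or `6` steps of the glued permutation. [folklore] -/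
theorem exists_pow_glue_inl (hτ : d.ModeOK b τ) (y : V) :
    ∃ k : ℕ, ((glue hd b τ) ^ k) (Sum.inl y) = Sum.inl (τ y) := by
  rcases plain_or (d := d) b y with hy | rfl | ⟨rfl, rfl | rfl⟩
  · exact ⟨1, by rw [pow_one, glue_inl_plain hd hτ hy]⟩
  · cases b
    · refine ⟨6, ?_⟩
      simp only [pow_succ', pow_zero, Perm.mul_apply, Perm.one_apply, glue_u₀ hd hτ]
      simp [hτ.1]
    · refine ⟨2, ?_⟩
      simp only [pow_succ', pow_zero, Perm.mul_apply, Perm.one_apply, glue_u₀ hd hτ]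
      simp [hτ.1]
  · refine ⟨2, ?_⟩
    simp only [pow_succ', pow_zero, Perm.mul_apply, Perm.one_apply, glue_u_true hd hτ]
    simp [hτ.2.1.2 rfl]
  · refine ⟨4, ?_⟩
    simp only [pow_succ', pow_zero, Perm.mul_apply, Perm.one_apply, glue_u'_true hd hτ]
    simp [hτ.2.2.2 rfl]

omit [Fintype V] in
/-- Every gadget vertex is reached from a vertex of `V` by the glued permutation. [folklore] -/
theorem exists_pow_glue_eq_inr (hτ : d.ModeOK b τ) (g : Fin 5) :
    ∃ (a : V) (k : ℕ), ((glue hd b τ) ^ k) (Sum.inl a) = Sum.inr g := by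
  cases b
  · refine ⟨d.u₀, g.val + 1, ?_⟩
    fin_cases g <;>
      simp only [pow_succ', pow_zero, Perm.mul_apply, Perm.one_apply, glue_u₀ hd hτ] <;> simp
  · fin_cases g
    · exact ⟨d.u₀, 1, by rw [pow_one]; exact glue_u₀ hd hτ⟩
    · exact ⟨d.u, 1, by rw [pow_one]; exact glue_u_true hd hτ⟩
    · refine ⟨d.u', 3, ?_⟩
      simp only [pow_succ', pow_zero, Perm.mul_apply, Perm.one_apply, glue_u'_true hd hτ]; simp
    · refine ⟨d.u', 2, ?_⟩
      simp only [pow_succ', pow_zero, Perm.mul_apply, Perm.one_apply, glue_u'_true hd hτ]; simp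
    · exact ⟨d.u', 1, by rw [pow_one]; exact glue_u'_true hd hτ⟩

/-- **Gluing a Hamiltonian permutation gives a Hamiltonian permutation.** [folklore] -/
theorem isHam_glue (hτ : d.ModeOK b τ) (hham : IsHam τ) : IsHam (glue hd b τ) := by
  have hV := three_le_card hd
  obtain ⟨hne, hsc⟩ := (isHam_iff (by omega) τ).1 hham
  rw [isHam_iff two_le_card_sum]
  set σ := glue hd b τ with hσ
  -- all of `V` lies in the orbit of `inl u₀`
  have horb : ∀ x : V, σ.SameCycle (Sum.inl d.u₀) (Sum.inl x) := by
    intro x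
    obtain ⟨n, -, hn⟩ := (hsc d.u₀ x).exists_pow_eq'
    rw [← hn]
    clear hn
    induction n with
    | zero => exact Perm.SameCycle.refl _ _
    | succ n ih =>
      refine ih.trans ?_
      obtain ⟨k, hk⟩ := exists_pow_glue_inl hd hτ ((τ ^ n) d.u₀)
      exact ⟨k, by rw [zpow_natCast, hk, pow_succ', Perm.mul_apply]⟩
  refine ⟨fun z => ?_, fun z z' => ?_⟩
  · rcases z with x | g
    · rcases plain_or (d := d) b x with hx | rfl | ⟨rfl, rfl | rfl⟩
      · rw [hσ, glue_inl_plain hd hτ hx]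
        simpa using hne x
      · rw [hσ, glue_u₀ hd hτ]; simp
      · rw [hσ, glue_u_true hd hτ]; simp
      · rw [hσ, glue_u'_true hd hτ]; simp
    · rw [hσ, glue_inr]
      cases b <;> fin_cases g <;> simp
  · have hall : ∀ z, σ.SameCycle (Sum.inl d.u₀) z := by
      intro z
      rcases z with x | g
      · exact horb x
      · obtain ⟨a, k, hk⟩ := exists_pow_glue_eq_inr hd hτ g
        exact (horb a).trans ⟨k, by rw [zpow_natCast, hk]⟩
    exact (hall z).symm.trans (hall z')

/-- The *anchor* of a vertex: itself on `V`, and the tail of its gadget path on the gadget. [folklore] -/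
def anchor (d : CoupleData V) (b : Bool) : V ⊕ Fin 5 → V
  | Sum.inl x => x
  | Sum.inr g => bif b then ![d.u₀, d.u, d.u', d.u', d.u'] g else d.u₀

omit [Fintype V] in
/-- One step of the glued permutation keeps the anchor or advances it by `τ`. [folklore] -/
theorem anchor_glue (hτ : d.ModeOK b τ) (z : V ⊕ Fin 5) :
    d.anchor b (glue hd b τ z) = d.anchor b z ∨ d.anchor b (glue hd b τ z) = τ (d.anchor b z) := by
  rcases z with x | g
  · rcases plain_or (d := d) b x with hx | rfl | ⟨rfl, rfl | rfl⟩
    · right; rw [glue_inl_plain hd hτ hx]; rfl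
    · left; rw [glue_u₀ hd hτ]; cases b <;> rfl
    · left; rw [glue_u_true hd hτ]; rfl
    · left; rw [glue_u'_true hd hτ]; rfl
  · rw [glue_inr]
    cases b
    · fin_cases g
      · left; rfl
      · left; rfl
      · left; rfl
      · left; rfl
      · right; simp [anchor, hτ.1]
    · fin_cases g
      · right; simp [anchor, hτ.1]
      · right; simp [anchor, hτ.2.1.2 rfl]
      · right; simp [anchor, hτ.2.2.2 rfl]
      · left; rfl
      · left; rfl

omit [Fintype V] in
/-- Iterating the glued permutation advances the anchor along `τ`. [folklore] -/
theorem anchor_pow_glue (hτ : d.ModeOK b τ) (n : ℕ) (z : V ⊕ Fin 5) :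
    ∃ j : ℕ, d.anchor b (((glue hd b τ) ^ n) z) = (τ ^ j) (d.anchor b z) := by
  induction n with
  | zero => exact ⟨0, by simp⟩
  | succ n ih =>
    obtain ⟨j, hj⟩ := ih
    rcases anchor_glue hd hτ (((glue hd b τ) ^ n) z) with h | h
    · exact ⟨j, by rw [pow_succ', Perm.mul_apply, h, hj]⟩
    · exact ⟨j + 1, by rw [pow_succ', Perm.mul_apply, h, hj, pow_succ', Perm.mul_apply]⟩

/-- **A glued permutation is Hamiltonian only if `τ` is.** [folklore] -/
theorem isHam_of_isHam_glue (hτ : d.ModeOK b τ) (h : IsHam (glue hd b τ)) : IsHam τ := by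
  have hV := three_le_card hd
  obtain ⟨hne, hsc⟩ := (isHam_iff two_le_card_sum _).1 h
  rw [isHam_iff (by omega)]
  refine ⟨fun x hx => ?_, fun x y => ?_⟩
  · rcases plain_or (d := d) b x with hpx | rfl | ⟨rfl, rfl | rfl⟩
    · exact hne (Sum.inl x) (by rw [glue_inl_plain hd hτ hpx, hx])
    · exact hd.u₀_s₀ (hx.symm.trans hτ.1)
    · exact hd.u_v (hx.symm.trans (hτ.2.1.2 rfl))
    · exact hd.u'_v' (hx.symm.trans (hτ.2.2.2 rfl))
  · obtain ⟨n, -, hn⟩ := (hsc (Sum.inl x) (Sum.inl y)).exists_pow_eq'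
    obtain ⟨j, hj⟩ := anchor_pow_glue hd hτ n (Sum.inl x)
    rw [hn] at hj
    exact ⟨j, by rw [zpow_natCast]; exact hj.symm⟩

end HamTransfer

/-! #### Decomposition: every admissible Hamiltonian permutation of the gadget graph is glued -/

section Decompose

variable {d} [Fintype V] (hd : d.Distinct) {M : Matrix V V R} (hM : d.Special M)
  {σ : Perm (V ⊕ Fin 5)} (hs : Supp (d.gadget M) σ)
include hd hM hs

omit [Fintype V] in
/-- In the neither pattern, vertices of `V` other than `u₀` are mapped into `V ∖ {s₀}`. [folklore] -/
theorem neither_inl (hN : d.Neither σ) {x : V} (hx : x ≠ d.u₀) :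
    ∃ y, σ (Sum.inl x) = Sum.inl y ∧ y ≠ d.s₀ := by
  have h0 := supp_u₀ hs hd hM
  obtain ⟨h1, h2, h3, h4, h5⟩ := hN
  have inj := σ.injective
  rcases hσx : σ (Sum.inl x) with y | g
  · refine ⟨y, rfl, fun hy => ?_⟩
    subst hy
    exact absurd (inj (hσx.trans h5.symm)) (by simp)
  · exfalso
    fin_cases g
    · exact hx (by simpa using inj (hσx.trans h0.symm))
    · exact absurd (inj (hσx.trans h1.symm)) (by simp)
    · exact absurd (inj (hσx.trans h2.symm)) (by simp)
    · exact absurd (inj (hσx.trans h3.symm)) (by simp)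
    · exact absurd (inj (hσx.trans h4.symm)) (by simp)

omit [Fintype V] in
/-- In the both pattern, vertices of `V` other than `u₀, u, u'` are mapped into `V ∖ {s₀, v, v'}`. [folklore] -/
theorem both_inl (hB : d.Both σ) {x : V} (hx : x ≠ d.u₀) (hxu : x ≠ d.u) (hxu' : x ≠ d.u') :
    ∃ y, σ (Sum.inl x) = Sum.inl y ∧ y ≠ d.s₀ ∧ y ≠ d.v ∧ y ≠ d.v' := by
  have h0 := supp_u₀ hs hd hM
  obtain ⟨h1, hu, h2, hu', h3, h4, h5⟩ := hB
  have inj := σ.injective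
  rcases hσx : σ (Sum.inl x) with y | g
  · refine ⟨y, rfl, fun hy => ?_, fun hy => ?_, fun hy => ?_⟩
    · subst hy; exact absurd (inj (hσx.trans h1.symm)) (by simp)
    · subst hy; exact absurd (inj (hσx.trans h2.symm)) (by simp)
    · subst hy; exact absurd (inj (hσx.trans h5.symm)) (by simp)
  · exfalso
    fin_cases g
    · exact hx (by simpa using inj (hσx.trans h0.symm))
    · exact hxu (by simpa using inj (hσx.trans hu.symm))
    · exact absurd (inj (hσx.trans h4.symm)) (by simp)
    · exact absurd (inj (hσx.trans h3.symm)) (by simp)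
    · exact hxu' (by simpa using inj (hσx.trans hu'.symm))

/-- **Decomposition.** A Hamiltonian permutation of full support of the gadget graph is the
gluing of a permutation `τ` of `V` consistent with one of the two modes. [folklore] -/
theorem exists_glue_eq (hham : IsHam σ) : ∃ (b : Bool) (τ : Perm V), d.ModeOK b τ ∧ glue hd b τ = σ := by
  have h0 := supp_u₀ hs hd hM
  rcases local_cases hs hd hM hham with hN | hB
  · -- neither mode: `ρ = pN⁻¹ σ` preserves `V`
    set ρ : Perm (V ⊕ Fin 5) := d.pN⁻¹ * σ with hρ
    have hρa : ∀ z, ρ z = d.pN.symm (σ z) := fun z => rfl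
    have hmaps : Set.MapsTo ρ (Set.range Sum.inl) (Set.range Sum.inl) := by
      rintro _ ⟨x, rfl⟩
      by_cases hx : x = d.u₀
      · subst hx; exact ⟨d.s₀, by rw [hρa, h0]; rfl⟩
      · obtain ⟨y, hy, hys⟩ := neither_inl hd hM hs hN hx
        exact ⟨y, by rw [hρa, hy]; simp [hys]⟩
    obtain ⟨⟨τ₁, τ₂⟩, hτ⟩ := MonoidHom.mem_range.1 (Perm.mem_sumCongrHom_range_of_perm_mapsTo_inl hmaps)
    rw [Perm.sumCongrHom_apply] at hτ
    have happ : ∀ z, Perm.sumCongr τ₁ τ₂ z = ρ z := fun z => by rw [hτ]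
    obtain ⟨h1, h2, h3, h4, h5⟩ := hN
    have e0 : d.pN.symm (σ (Sum.inr 0)) = Sum.inr 0 := by rw [h1]; rfl
    have e1 : d.pN.symm (σ (Sum.inr 1)) = Sum.inr 1 := by rw [h2]; rfl
    have e2 : d.pN.symm (σ (Sum.inr 2)) = Sum.inr 2 := by rw [h3]; rfl
    have e3 : d.pN.symm (σ (Sum.inr 3)) = Sum.inr 3 := by rw [h4]; rfl
    have e4 : d.pN.symm (σ (Sum.inr 4)) = Sum.inr 4 := by rw [h5]; simp
    have key : ∀ g : Fin 5, d.pN.symm (σ (Sum.inr g)) = Sum.inr g := by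
      intro g; fin_cases g
      · exact e0
      · exact e1
      · exact e2
      · exact e3
      · exact e4
    have hτ₂ : τ₂ = 1 := Equiv.ext fun g => by
      have := happ (Sum.inr g)
      rw [hρa, key g] at this
      simpa using this
    rw [hτ₂] at hτ happ
    have hσ : glue hd false τ₁ = σ := by
      rw [glue, ins_false, lift, hτ, hρ, mul_inv_cancel_left]
    have hu₀ : τ₁ d.u₀ = d.s₀ := by
      have := happ (Sum.inl d.u₀)
      rw [hρa, h0] at this; simpa using this
    refine ⟨false, τ₁, ⟨hu₀, ?_, ?_⟩, hσ⟩
    · simp only [Bool.false_eq_true, iff_false]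
      intro e
      apply supp_u_ne hs
      rw [← hσ, glue_inl, e]; simp [hd.s₀_v.symm]
    · simp only [Bool.false_eq_true, iff_false]
      intro e
      apply supp_u'_ne hs
      rw [← hσ, glue_inl, e]; simp [hd.s₀_v'.symm]
  · -- both mode: `ρ = pB⁻¹ σ` preserves `V`
    set ρ : Perm (V ⊕ Fin 5) := (d.pB hd)⁻¹ * σ with hρ
    have hρa : ∀ z, ρ z = (d.pB hd).symm (σ z) := fun z => rfl
    obtain ⟨h1, hu, h2, hu', h3, h4, h5⟩ := hB
    have hmaps : Set.MapsTo ρ (Set.range Sum.inl) (Set.range Sum.inl) := by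
      rintro _ ⟨x, rfl⟩
      by_cases hx : x = d.u₀
      · subst hx; exact ⟨d.s₀, by rw [hρa, h0]; rfl⟩
      by_cases hxu : x = d.u
      · subst hxu; exact ⟨d.v, by rw [hρa, hu]; rfl⟩
      by_cases hxu' : x = d.u'
      · subst hxu'; exact ⟨d.v', by rw [hρa, hu']; rfl⟩
      · obtain ⟨y, hy, hys, hyv, hyv'⟩ := both_inl hd hM hs ⟨h1, hu, h2, hu', h3, h4, h5⟩ hx hxu hxu'
        exact ⟨y, by rw [hρa, hy]; simp [hys, hyv, hyv']⟩
    obtain ⟨⟨τ₁, τ₂⟩, hτ⟩ := MonoidHom.mem_range.1 (Perm.mem_sumCongrHom_range_of_perm_mapsTo_inl hmaps)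
    rw [Perm.sumCongrHom_apply] at hτ
    have happ : ∀ z, Perm.sumCongr τ₁ τ₂ z = ρ z := fun z => by rw [hτ]
    have hsv := hd.s₀_v; have hsv' := hd.s₀_v'; have hvv' := hd.v_v'
    have e0 : (d.pB hd).symm (σ (Sum.inr 0)) = Sum.inr 0 := by rw [h1]; simp
    have e1 : (d.pB hd).symm (σ (Sum.inr 1)) = Sum.inr 1 := by rw [h2]; simp [hsv.symm]
    have e2 : (d.pB hd).symm (σ (Sum.inr 2)) = Sum.inr 2 := by
      rw [h5]; simp [hsv'.symm, hvv'.symm]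
    have e3 : (d.pB hd).symm (σ (Sum.inr 3)) = Sum.inr 3 := by rw [h4]; rfl
    have e4 : (d.pB hd).symm (σ (Sum.inr 4)) = Sum.inr 4 := by rw [h3]; rfl
    have key : ∀ g : Fin 5, (d.pB hd).symm (σ (Sum.inr g)) = Sum.inr g := by
      intro g; fin_cases g
      · exact e0
      · exact e1
      · exact e2
      · exact e3
      · exact e4
    have hτ₂ : τ₂ = 1 := Equiv.ext fun g => by
      have := happ (Sum.inr g)
      rw [hρa, key g] at this
      simpa using this
    rw [hτ₂] at hτ happ
    have hσ : glue hd true τ₁ = σ := by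
      rw [glue, ins_true, lift, hτ, hρ, mul_inv_cancel_left]
    have hu₀ : τ₁ d.u₀ = d.s₀ := by
      have := happ (Sum.inl d.u₀)
      rw [hρa, h0] at this; simpa using this
    refine ⟨true, τ₁, ⟨hu₀, ?_, ?_⟩, hσ⟩
    · simp only [iff_true]
      have := happ (Sum.inl d.u)
      rw [hρa, hu] at this; simpa using this
    · simp only [iff_true]
      have := happ (Sum.inl d.u')
      rw [hρa, hu'] at this; simpa using this

end Decompose

/-! #### The couple-removal theorem -/

section Main

variable {d} [Fintype V] (hd : d.Distinct) {M : Matrix V V R} (hM : d.Special M)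

omit [Fintype V] in
/-- A permutation using the special edge and respecting the couple is consistent with the mode read off `τ u`. [folklore] -/
theorem modeOK_decide {τ : Perm V} (hu₀ : τ d.u₀ = d.s₀) (hsat : Couple.Sat τ d.couple) :
    d.ModeOK (decide (τ d.u = d.v)) τ := by
  refine ⟨hu₀, by simp, ?_⟩
  unfold Couple.Sat couple at hsat
  dsimp only at hsat
  rw [← hsat]; simp

omit [Fintype V] in
include hM in
/-- A permutation of full support in a special matrix uses the special edge. [folklore] -/
theorem apply_u₀_of_supp {τ : Perm V} (h : Supp M τ) : τ d.u₀ = d.s₀ := by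
  by_contra hne
  exact h d.u₀ (hM.out _ hne)

include hd hM in
/-- **Removing a couple** (von zur Gathen 1987, proof of Thm. 5.6, (11.1): `hc(C; P) =
hc(H; P ∪ {{e, e'}})` for the graph `C = γ(H, {e, e'})` with six new vertices; here with the
five-vertex gadget `gadget`): if `M` is special at `(u₀, s₀)` and the couples of `P` avoid the
three rerouted edges, the coupled Hamiltonian cycle sum of the gadget graph under `P` equals that
of `M` under `P` together with the couple `{(u, v), (u', v')}`. The gadget graph is again special,
at `(u₀, g₀)` (`special_gadget`). [cite: vonzurGathen1987, Thm. 5.6] -/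
theorem hcC_gadget (P : List (Couple V)) (hP : ∀ c ∈ P, d.Avoids c.1 ∧ d.Avoids c.2) :
    hcC (d.gadget M) (P.map (Couple.map Sum.inl)) = hcC M (d.couple :: P) := by
  rcases subsingleton_or_nontrivial R with hR | hR
  · exact Subsingleton.elim _ _
  rw [hcC_eq_sum_supp, hcC_eq_sum_supp]
  symm
  refine Finset.sum_nbij (fun τ => d.expand hd τ) ?_ ?_ ?_ ?_
  · intro τ hτ
    simp only [mem_filter, mem_univ, true_and, List.mem_cons, forall_eq_or_imp, List.mem_map,
      forall_exists_index, and_imp] at hτ ⊢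
    obtain ⟨⟨hham, hsatc, hsatP⟩, hsupp⟩ := hτ
    have hmode := modeOK_decide (apply_u₀_of_supp hM hsupp) hsatc
    rw [expand_eq_glue]
    refine ⟨⟨isHam_glue hd hmode hham, ?_⟩, (supp_glue_iff hd hM hmode).2 hsupp⟩
    rintro _ c₀ hc₀ rfl
    exact (sat_glue_iff hd hmode (hP c₀ hc₀).1 (hP c₀ hc₀).2).2 (hsatP c₀ hc₀)
  · intro τ₁ _ τ₂ _ heq
    change d.expand hd τ₁ = d.expand hd τ₂ at heq
    rw [expand_eq_glue, expand_eq_glue] at heq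
    have hb : decide (τ₁ d.u = d.v) = decide (τ₂ d.u = d.v) := by
      have h0 := congrArg (fun ρ : Perm (V ⊕ Fin 5) => ρ (Sum.inr 0)) heq
      simp only [glue_inr] at h0
      revert h0
      cases decide (τ₁ d.u = d.v) <;> cases decide (τ₂ d.u = d.v) <;> simp
    rw [hb] at heq
    unfold glue at heq
    have hl := mul_left_cancel heq
    ext x
    have := congrArg (fun ρ : Perm (V ⊕ Fin 5) => ρ (Sum.inl x)) hl
    simpa using this
  · intro σ hσ
    simp only [coe_filter, mem_univ, true_and, Set.mem_setOf_eq, List.mem_map,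
      forall_exists_index, and_imp] at hσ
    obtain ⟨⟨hham, hsat⟩, hsupp⟩ := hσ
    obtain ⟨b, τ, hmode, hglue⟩ := exists_glue_eq hd hM hsupp hham
    refine ⟨τ, ?_, ?_⟩
    · simp only [coe_filter, mem_univ, true_and, Set.mem_setOf_eq, List.mem_cons,
        forall_eq_or_imp]
      refine ⟨⟨isHam_of_isHam_glue hd hmode (hglue ▸ hham), sat_couple_of_modeOK hmode,
        fun c hc => ?_⟩, ?_⟩
      · have := hsat (c.map Sum.inl) c hc rfl
        rw [← hglue] at this
        exact (sat_glue_iff hd hmode (hP c hc).1 (hP c hc).2).1 this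
      · rw [← hglue] at hsupp
        exact (supp_glue_iff hd hM hmode).1 hsupp
    · change d.expand hd τ = σ
      rw [expand_eq_glue, ← hglue]
      have hb : decide (τ d.u = d.v) = b := by
        have h := hmode.2.1
        cases b <;> simpa using h
      rw [hb]
  · intro τ hτ
    simp only [mem_filter, mem_univ, true_and, List.mem_cons, forall_eq_or_imp] at hτ
    obtain ⟨⟨-, hsatc, -⟩, hsupp⟩ := hτ
    have hmode := modeOK_decide (apply_u₀_of_supp hM hsupp) hsatc
    change _ = ∏ i, d.gadget M (d.expand hd τ i) i
    rw [expand_eq_glue, prod_gadget_glue hd hM hmode]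

omit [Fintype V] in
include hd hM in
/-- The gadget graph is special at `(u₀, g₀)`: the only edge leaving `u₀` and the only edge
entering `g₀` is `u₀ → g₀`, of weight `1` (von zur Gathen 1987, proof of Thm. 5.6: "the special
edge of `C` is `(u₀, c₁)`"). [cite: vonzurGathen1987, Thm. 5.6] -/
theorem special_gadget (e : Couple (V ⊕ Fin 5)) :
    CoupleData.Special ⟨Sum.inl d.u₀, Sum.inr 0, e.1.1, e.1.2, e.2.1, e.2.2⟩ (d.gadget M) := by
  have h1 := hd.u₀_u; have h2 := hd.u₀_u'
  refine ⟨fun y hy => ?_, fun x hx => ?_, ?_⟩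
  · rcases y with y | g
    · simp only [gadget]
      split_ifs with h
      · rfl
      · exact hM.out y fun e => h (by simp [e])
    · have hg : g ≠ 0 := fun e => hy (by rw [e])
      fin_cases g <;> simp [gadget, h1, h2] at hg ⊢
  · rcases x with x | g
    · have hx' : x ≠ d.u₀ := fun e => hx (by rw [e])
      simp [gadget, hx']
    · fin_cases g <;> simp [gadget]
  · simp [gadget]

end Main

end CoupleData

/-! ### Removing all couples -/

section Iterate

/-- Well-formedness of a list of couples with respect to a special edge `u₀ → s₀`: in each couple
the two tails differ, the two heads differ, no coupled edge is a loop, no tail is `u₀`, no head is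
`s₀`; and distinct couples share no edge (von zur Gathen 1987, §5: "a set of couples of edges",
`u ≠ u'`, `v ≠ v'`, `a ≠ b ⇔ a ∩ b = ∅`, and the special edge occurs in no couple). [cite: vonzurGathen1987, §5] -/
structure GoodCouples {V : Type u} (u₀ s₀ : V) (P : List (Couple V)) : Prop where
  tails : ∀ c ∈ P, c.1.1 ≠ c.2.1
  heads : ∀ c ∈ P, c.1.2 ≠ c.2.2
  loop₁ : ∀ c ∈ P, c.1.1 ≠ c.1.2
  loop₂ : ∀ c ∈ P, c.2.1 ≠ c.2.2
  tail_ne₁ : ∀ c ∈ P, c.1.1 ≠ u₀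
  tail_ne₂ : ∀ c ∈ P, c.2.1 ≠ u₀
  head_ne₁ : ∀ c ∈ P, c.1.2 ≠ s₀
  head_ne₂ : ∀ c ∈ P, c.2.2 ≠ s₀
  disjoint : P.Pairwise fun c c' => c.1 ≠ c'.1 ∧ c.1 ≠ c'.2 ∧ c.2 ≠ c'.1 ∧ c.2 ≠ c'.2

/-- `M` is *special* at `(u₀, s₀)` (von zur Gathen's special graphs: the only edge leaving `u₀`
and the only edge entering `s₀` is `u₀ → s₀`, of weight `1`), as a predicate on the pair alone
(`CoupleData.Special` with the couple fields unused). [cite: vonzurGathen1987, Thm. 5.6] -/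
abbrev IsSpecial {V : Type u} (u₀ s₀ : V) (M : Matrix V V R) : Prop :=
  CoupleData.Special ⟨u₀, s₀, u₀, s₀, u₀, s₀⟩ M

/-- **Removing all couples** (von zur Gathen 1987, proof of Thm. 5.6, (12.1)–(12.3): iterating
the couple removal `p` times from a special graph gives an ordinary Hamiltonian cycle sum on
`6p` — here `5p` — more vertices, all new weights being `0` or `1`): for a weight matrix `M`
special at `(u₀, s₀)` and a well-formed list `P` of couples there is a square matrix `M'` of size
`#V + 5·|P|`, whose entries are entries of `M` or `0` or `1` (expressed through an arbitrary
predicate `good` containing `0`, `1` and the entries of `M`), with `HC(M') = hc(M; P)`. [cite: vonzurGathen1987, Thm. 5.6] -/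
theorem exists_hamiltonianCycleSum_eq_hcC (good : R → Prop) (h0 : good 0) (h1 : good 1) :
    ∀ (n : ℕ) {V : Type u} [Fintype V] [DecidableEq V] (M : Matrix V V R) (u₀ s₀ : V)
      (P : List (Couple V)), P.length = n → (∀ i j, good (M i j)) →
      IsSpecial u₀ s₀ M → u₀ ≠ s₀ → GoodCouples u₀ s₀ P →
      ∃ (N : ℕ) (M' : Matrix (Fin N) (Fin N) R), N = Fintype.card V + 5 * n ∧
        (∀ i j, good (M' i j)) ∧ M'.hamiltonianCycleSum = hcC M P := by
  intro n
  induction n with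
  | zero =>
    intro V _ _ M u₀ s₀ P hP hgood _ _ _
    obtain rfl : P = [] := List.length_eq_zero_iff.1 hP
    refine ⟨Fintype.card V, M.submatrix (Fintype.equivFin V).symm (Fintype.equivFin V).symm,
      by simp, fun i j => hgood _ _, ?_⟩
    rw [Matrix.hamiltonianCycleSum_submatrix_equiv, hcC_nil]
  | succ n ih =>
    intro V _ _ M u₀ s₀ P hP hgood hM hus hG
    obtain ⟨c, P, rfl⟩ : ∃ c P', P = c :: P' := by
      cases P with
      | nil => simp at hP
      | cons c P' => exact ⟨c, P', rfl⟩
    simp only [List.length_cons, Nat.add_right_cancel_iff] at hP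
    -- the data of the first couple
    set d : CoupleData V := ⟨u₀, s₀, c.1.1, c.1.2, c.2.1, c.2.2⟩ with hd_def
    have hc : c ∈ c :: P := List.mem_cons_self
    have hd : d.Distinct :=
      ⟨(hG.tail_ne₁ c hc).symm, (hG.tail_ne₂ c hc).symm, hG.tails c hc, (hG.head_ne₁ c hc).symm,
        (hG.head_ne₂ c hc).symm, hG.heads c hc, hus, hG.loop₁ c hc, hG.loop₂ c hc⟩
    have hMd : d.Special M := ⟨hM.out, hM.inn, hM.one⟩
    have hcouple : d.couple = c := rfl
    -- the remaining couples avoid the rerouted edges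
    have hPav : ∀ c' ∈ P, d.Avoids c'.1 ∧ d.Avoids c'.2 := by
      intro c' hc'
      have hdis := List.pairwise_cons.1 hG.disjoint
      obtain ⟨h11, h12, h21, h22⟩ := hdis.1 c' hc'
      have hc'm : c' ∈ c :: P := List.mem_cons_of_mem _ hc'
      refine ⟨⟨Ne.symm h11, Ne.symm h21, fun e => hG.tail_ne₁ c' hc'm ?_⟩,
        ⟨Ne.symm h12, Ne.symm h22, fun e => hG.tail_ne₂ c' hc'm ?_⟩⟩
      · exact (Prod.ext_iff.1 e).1
      · exact (Prod.ext_iff.1 e).1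
    have hstep := CoupleData.hcC_gadget hd hMd P hPav
    rw [hcouple] at hstep
    -- apply the induction hypothesis to the gadget graph
    have hgood' : ∀ i j, good (d.gadget M i j) := by
      intro i j
      rcases i with i | i <;> rcases j with j | j <;> simp only [CoupleData.gadget] <;>
        split_ifs <;> first | exact h0 | exact h1 | exact hgood _ _
    have hspec' := CoupleData.special_gadget hd hMd ((Sum.inl d.u₀, Sum.inr 0), (Sum.inl d.u₀, Sum.inr 0))
    have hG' : GoodCouples (Sum.inl d.u₀) (Sum.inr (0 : Fin 5)) (P.map (Couple.map Sum.inl)) := by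
      refine ⟨?_, ?_, ?_, ?_, ?_, ?_, ?_, ?_, ?_⟩
      · intro c' hc'; obtain ⟨c₀, hc₀, rfl⟩ := List.mem_map.1 hc'
        simpa [Couple.map] using hG.tails c₀ (List.mem_cons_of_mem _ hc₀)
      · intro c' hc'; obtain ⟨c₀, hc₀, rfl⟩ := List.mem_map.1 hc'
        simpa [Couple.map] using hG.heads c₀ (List.mem_cons_of_mem _ hc₀)
      · intro c' hc'; obtain ⟨c₀, hc₀, rfl⟩ := List.mem_map.1 hc'
        simpa [Couple.map] using hG.loop₁ c₀ (List.mem_cons_of_mem _ hc₀)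
      · intro c' hc'; obtain ⟨c₀, hc₀, rfl⟩ := List.mem_map.1 hc'
        simpa [Couple.map] using hG.loop₂ c₀ (List.mem_cons_of_mem _ hc₀)
      · intro c' hc'; obtain ⟨c₀, hc₀, rfl⟩ := List.mem_map.1 hc'
        simpa [Couple.map] using hG.tail_ne₁ c₀ (List.mem_cons_of_mem _ hc₀)
      · intro c' hc'; obtain ⟨c₀, hc₀, rfl⟩ := List.mem_map.1 hc'
        simpa [Couple.map] using hG.tail_ne₂ c₀ (List.mem_cons_of_mem _ hc₀)
      · intro c' hc'; obtain ⟨c₀, hc₀, rfl⟩ := List.mem_map.1 hc'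
        simp [Couple.map]
      · intro c' hc'; obtain ⟨c₀, hc₀, rfl⟩ := List.mem_map.1 hc'
        simp [Couple.map]
      · have hdis := (List.pairwise_cons.1 hG.disjoint).2
        rw [List.pairwise_map]
        refine hdis.imp fun {a b} h => ?_
        simp only [Couple.map, ne_eq, Prod.mk.injEq, Sum.inl.injEq]
        simp only [ne_eq, Prod.ext_iff] at h
        exact h
    obtain ⟨N, M', hN, hgoodM', hM'⟩ := ih (d.gadget M) (Sum.inl d.u₀) (Sum.inr 0)
      (P.map (Couple.map Sum.inl)) (by simp [hP]) hgood' hspec' (by simp) hG'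
    refine ⟨N, M', ?_, hgoodM', ?_⟩
    · rw [hN, Fintype.card_sum, Fintype.card_fin]; ring
    · rw [hM', hstep]

end Iterate

end Gadget

end Literature.Computability.AlgebraicComplexity
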